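import Summits.RiemannHypothesis.RiemannHypothesis.Theorems.TiltedLandingLaw421R3Forms

/-! # TiltedLandingLaw421R3Bot
SUPPORT module for crux `TiltedLandingLaw421` (stmt-RiemannHypothesis-24774), `--supports … --as helper` only: proves no stub, no crux; fully proved (no `sorry`).
W-08 ROUND-3 (director (CA328): REST keyed ONCE, seal-free — load-bearing text β(⊥) = `RhW08.SealSwap.ZRestTrkSHFR PBot`, node `RhW08.SealSwap.law421T_of_alphaFree`, NO α stub)
cut by tenure rh-tenure-earlyapp-1 g6 from the single rc-0 base `baseR3B-W08-C1-rh-idea-5-g24.lean` sha256 d40e31646095b7fde3065497986c3084cc5ea105967bb05e8f2cf722ca32e3b9 (C1 g24 base baseR3B-W08-C1-rh-idea-5-g24.lean d40e31646095b7fd): decl blocks byte-verbatim, base order, dependency closure of the roots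
{law421T_of_alphaFree, zRestTrkSBot_of_succ_rate, RestSuccBot, RestRateBot, law421T_of_succ_rate, zRestTrkSHFR_bot_iff_succ_rate, chargedBot_iff, RestInitBot, restInitBot_of_rate, restInitBot_iff_purse, exists_readyR2_le_of_succ_rate} minus every declaration already LANDED in the round-2 tree chain (#986 R2StSwap · #988 R2Ready · #991 R2TrkD · #994 R2NodeD · #998 R2NodeDR · #999 R2CoreP · #1000 R2FlatM).
K = kernel-checked lemmas about MODEL sockets (combs / polynomials), not ζ/Ξ. Typed ≠ proved; RH is not proved; 24774 OPEN. -/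

namespace RhW08.StSwap

open RhIdea6.G17.W07C7 RhIdea6.G17.W07C7.Rev6 RhIdea6.G18.W07C8.Law421BirthS RhIdea6.G19.W07C11.Seam
open RhIdea6.G20.W07C12.Frac RhIdea6.G20.W07C12.StColP RhW07.C12.FieldSplit RhIdea6.G21.W07C13.TentMax
open RhW07.C14.TwoSided RhW07.C14.Classes RhW07.C14.Lineage RhW07.C14.Booking
open RhW07.C13.Heredity RhIdea6.G22.W07C15pre.Injection RhW07.E3.Cell RhW07.E3.Lit

section LowestHeight

/-- (K) the lowest height is non-negative. -/
theorem lowH_nonneg (St : StatePred) (η : ℝ) (f : ℂ → ℂ) (x₀ s hmax R Hs : ℝ) (B j : ℕ) : 0 ≤ lowH St η f x₀ s hmax R Hs B j := by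
  apply Real.sInf_nonneg
  rintro _ ⟨u, -, rfl⟩
  exact abs_nonneg _
end LowestHeight

section CanonicalToll

/-- (K) `chargeCount … 0 = 0`. -/
theorem chargeCount_zero (P St Ready : StatePred) (η : ℝ) (f : ℂ → ℂ) (x₀ s hmax R Hs : ℝ) (B : ℕ) :
    chargeCount P St Ready η f x₀ s hmax R Hs B 0 = 0 := by
  simp [chargeCount]

open Classical in
/-- (K) `chargeCount … (k+1) = chargeCount … k + [Charged k]`. -/
theorem chargeCount_succ (P St Ready : StatePred) (η : ℝ) (f : ℂ → ℂ) (x₀ s hmax R Hs : ℝ) (B k : ℕ) :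
    chargeCount P St Ready η f x₀ s hmax R Hs B (k + 1)
      = chargeCount P St Ready η f x₀ s hmax R Hs B k + (if Charged P St Ready η f x₀ s hmax R Hs B k then (1 : ℝ) else 0) := by
  simp only [chargeCount, Finset.sum_range_succ]
end CanonicalToll

end RhW08.StSwap

namespace RhW08.SealSwap

open Complex
open RhIdea6.G17.W07C7 RhIdea6.G17.W07C7.Rev6 RhIdea6.G18.W07C8.Law421BirthS RhIdea6.G19.W07C11.Seam
open RhIdea6.G20.W07C12.Frac RhIdea6.G20.W07C12.StColP RhW07.C12.FieldSplit RhIdea6.G21.W07C13.TentMax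
open RhW07.C14.TwoSided RhW07.C14.Classes RhW07.C14.Lineage RhW07.C14.Booking
open RhW07.C13.Heredity RhIdea6.G22.W07C15pre.Injection RhW07.E3.Cell
open RhW07.E3.Lit
open RhW08.Round1 RhW08.StSwap RhW08.Round2

section Family

/-- ★★ §K.16b **α(Pσ)** — at a sealed lowest non-ready tracked state the tracked successor sits `s/4` lower. (`AlphaSealTrkS PSealC4` IS `AlphaSealTrkD′`.) -/
def AlphaSealTrkS (Pσ : StatePred) : Prop := IsolatedPairDropLowG (1 / 4) Pσ StTrkD ReadyR2

/-- the EMPTY seal (nothing is ever sealed): the α-free corner of the family. -/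
def PBot : StatePred := fun _ _ _ _ _ _ _ _ _ _ => False

/-- (K) L2′ for every member of the family (`lineageLawG_sigmaMin`). -/
theorem lineageLawTrkS (Pσ : StatePred) : LineageLawG (PTrkS Pσ) StTrkD ReadyR2 EmptyTrkD (SigmaMinTrkS Pσ) (tentMeterTrkD (3 / 2)) :=
  lineageLawG_sigmaMin

/-- (K) α(Pσ) transfers to the disjunctive charge co-predicate for free. -/
theorem alphaTrkS_of {Pσ : StatePred} (h : AlphaSealTrkS Pσ) : IsolatedPairDropLowG (1 / 4) (PTrkS Pσ) StTrkD ReadyR2 :=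
  isolatedPairDropLowG_pOr_succOf h

/-- ★★★ §K.16b (K) **THE NODE FOR EVERY SEAL**: `β(Pσ) → α(Pσ) → TiltedLandingLaw421` (the glue of `law421T_of_round2DFR`, seal abstracted). -/
theorem law421T_of_round3S (Pσ : StatePred) (hR : ZRestTrkSHFR Pσ) (hα : AlphaSealTrkS Pσ) :
    Summit.RiemannHypothesis.RiemannHypothesis.Theses.EarlyAppointments.TiltedLandingLaw421 :=
  law421T_of_descentSig3
    (RhW08.Round2.descentSig3_of_lineageHF le_rfl stateFree_readyR2 (landLe3_readyR2 _) upperStates_stTrkD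
      (hasLowestSig_of_levelFinite levelFinite_stTrkD)
      (initHeightG_heightBudget levelFinite_stTrkD init0Sig_stTrkD (tentMeterTrkD (3 / 2))) (lineageLawTrkS Pσ) hR (alphaTrkS_of hα))
    analyticHeredity_landed
end Family

section SealSwap

/-- ★ (K) the α of the EMPTY seal is trivially true. -/
theorem alphaSealTrkS_bot : AlphaSealTrkS PBot := fun _ _ _ _ _ _ _ _ _ _ _ _ _ hp => hp.elim

/-- ★★★ §K.16b (K) **THE α-FREE NODE**: the β of the empty seal ALONE closes the crux (its α is `alphaSealTrkS_bot`). -/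
theorem law421T_of_alphaFree (hR : ZRestTrkSHFR PBot) :
    Summit.RiemannHypothesis.RiemannHypothesis.Theses.EarlyAppointments.TiltedLandingLaw421 :=
  law421T_of_round3S PBot hR alphaSealTrkS_bot
end SealSwap

section Horizon

open Classical in
/-- ★★ §K.16d (K) **PRE-HORIZON DEPTH BOUND**: under β(Pσ) ∧ α(Pσ), if no level `< k` is Ready′ then every level `≤ k` is inhabited and
`k + 4·lowH k/s ≤ (Hs/s)² + B + 1 + 4·hmax/s` (each pre-horizon level is charged — billed 1 — or free with a drop `≥ s/4` — billed `≥ 1` in the rate form). -/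
theorem preHorizon_depth_le {Pσ : StatePred} (hR : ZRestTrkSHFR Pσ) (hα : AlphaSealTrkS Pσ) {η : ℝ} {f : ℂ → ℂ} {x₀ s hmax R Hs : ℝ} {B : ℕ}
    (hE : EngineHyps5 2 η f x₀ s hmax R Hs B) {k : ℕ} (hpre : ∀ i : ℕ, i < k → ∀ v : ℂ, ¬ ReadyR2 η f x₀ s hmax R Hs B i v) :
    (∃ u : ℂ, StTrkD η f x₀ s hmax R Hs B k u) ∧
      (k : ℝ) + 4 * lowH StTrkD η f x₀ s hmax R Hs B k / s ≤ (Hs / s) ^ 2 + (B : ℝ) + 1 + 4 * hmax / s := by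
  classical
  have hs : 0 < s := hE.2.2.2.1
  obtain ⟨hSn, hB⟩ := (zRestTrkSHFR_iff_rate Pσ).1 hR η f x₀ s hmax R Hs B hE
  have key : ∀ j : ℕ, j ≤ k → (∃ u : ℂ, StTrkD η f x₀ s hmax R Hs B j u) ∧
      (j : ℝ) ≤ chargeCount (PTrkS Pσ) StTrkD ReadyR2 η f x₀ s hmax R Hs B j
        + ∑ i ∈ Finset.range j, (if Charged (PTrkS Pσ) StTrkD ReadyR2 η f x₀ s hmax R Hs B i then 0 else
            4 * (lowH StTrkD η f x₀ s hmax R Hs B i - lowH StTrkD η f x₀ s hmax R Hs B (i + 1)) / s) := by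
    intro j
    induction j with
    | zero =>
      intro _
      obtain ⟨u, hu, -⟩ := init0Sig_stTrkD η f x₀ s hmax R Hs B hE
      refine ⟨⟨u, hu⟩, ?_⟩
      rw [chargeCount_zero, Finset.sum_range_zero]
      norm_num
    | succ j ih =>
      intro hjk
      have hjlt : j < k := Nat.lt_of_succ_le hjk
      obtain ⟨⟨u, hu⟩, hih⟩ := ih hjlt.le
      rw [chargeCount_succ, Finset.sum_range_succ]
      push_cast
      by_cases hC : Charged (PTrkS Pσ) StTrkD ReadyR2 η f x₀ s hmax R Hs B j
      · obtain ⟨u', hu'⟩ := hSn j hC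
        refine ⟨⟨u', hu'⟩, ?_⟩
        rw [if_pos hC, if_pos hC]
        linarith
      · obtain ⟨v, hv, hveq⟩ := exists_isLowest_eq_lowH levelFinite_stTrkD upperStates_stTrkD hE hu
        have hnr : ¬ ReadyR2 η f x₀ s hmax R Hs B j v := hpre j hjlt v
        have hP : PTrkS Pσ η f x₀ s hmax R Hs B j v := by
          by_contra hnP
          exact hC ⟨v, hv, hnr, hnP⟩
        have hSucc : SuccOf (1 / 4) StTrkD η f x₀ s hmax R Hs B j v := by
          rcases hP with hσ | hsucc
          · exact hα η f x₀ s hmax R Hs B hE j v hv hnr hσ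
          · exact hsucc
        obtain ⟨u', hu', hdrop⟩ := hSucc
        have h1 : lowH StTrkD η f x₀ s hmax R Hs B (j + 1) ≤ |u'.im| := lowH_le hu'
        refine ⟨⟨u', hu'⟩, ?_⟩
        rw [if_neg hC, if_neg hC]
        have h2 : 1 ≤ 4 * (lowH StTrkD η f x₀ s hmax R Hs B j - lowH StTrkD η f x₀ s hmax R Hs B (j + 1)) / s := by
          rw [le_div_iff₀ hs]
          linarith
        linarith
  obtain ⟨hinh, hk⟩ := key k le_rfl
  refine ⟨hinh, ?_⟩
  have hcrd := le_max_right (tentMeterTrkD (3 / 2) η f x₀ s hmax R Hs B 0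
    - injected (PTrkS Pσ) StTrkD ReadyR2 EmptyTrkD η f x₀ s hmax R Hs B k) 0
  have h3 := hB k
  linarith

/-- ★★★ §K.16d (K) **HORIZON (STOP-TIME) BOUND**: under β(Pσ) ∧ α(Pσ), on every legal frame Ready′ is switched on at some level
`j ≤ (Hs/s)² + B + 1 + 4·hmax/s` (Ready′ is state-free). So C1's stop-time lemma (WORDS-47R H2) is a COROLLARY of the two stubs, not an extra hypothesis. -/
theorem exists_readyR2_le {Pσ : StatePred} (hR : ZRestTrkSHFR Pσ) (hα : AlphaSealTrkS Pσ) {η : ℝ} {f : ℂ → ℂ} {x₀ s hmax R Hs : ℝ} {B : ℕ}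
    (hE : EngineHyps5 2 η f x₀ s hmax R Hs B) :
    ∃ j : ℕ, (j : ℝ) ≤ (Hs / s) ^ 2 + (B : ℝ) + 1 + 4 * hmax / s ∧ ∀ u : ℂ, ReadyR2 η f x₀ s hmax R Hs B j u := by
  classical
  have hs : 0 < s := hE.2.2.2.1
  have hsh : 2 * s ≤ hmax := hE.2.2.2.2.1
  have hb : 0 ≤ (Hs / s) ^ 2 + (B : ℝ) + 1 + 4 * hmax / s := by
    have h1 : 0 ≤ (Hs / s) ^ 2 := sq_nonneg _
    have h2 : (0 : ℝ) ≤ (B : ℝ) := Nat.cast_nonneg _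
    have h3 : 0 ≤ 4 * hmax / s := div_nonneg (by linarith) hs.le
    linarith
  by_contra hcon
  have hall : ∀ i : ℕ, i < ⌊(Hs / s) ^ 2 + (B : ℝ) + 1 + 4 * hmax / s⌋₊ + 1 → ∀ v : ℂ, ¬ ReadyR2 η f x₀ s hmax R Hs B i v := by
    intro i hi v hv
    apply hcon
    refine ⟨i, ?_, fun u => stateFree_readyR2 η f x₀ s hmax R Hs B i v u hv⟩
    have h1 : (i : ℝ) ≤ (⌊(Hs / s) ^ 2 + (B : ℝ) + 1 + 4 * hmax / s⌋₊ : ℝ) := by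
      exact_mod_cast Nat.lt_succ_iff.mp hi
    exact h1.trans (Nat.floor_le hb)
  obtain ⟨-, hdepth⟩ := preHorizon_depth_le hR hα hE hall
  have h2 : 0 ≤ 4 * lowH StTrkD η f x₀ s hmax R Hs B (⌊(Hs / s) ^ 2 + (B : ℝ) + 1 + 4 * hmax / s⌋₊ + 1) / s :=
    div_nonneg (mul_nonneg (by norm_num) (lowH_nonneg _ _ _ _ _ _ _ _ _ _)) hs.le
  have h3 := Nat.lt_floor_add_one ((Hs / s) ^ 2 + (B : ℝ) + 1 + 4 * hmax / s)
  push_cast at hdepth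
  linarith

/-- (K) the α-FREE instance of the horizon bound: `β(PBot)` alone bounds the horizon. -/
theorem exists_readyR2_le_alphaFree (hR : ZRestTrkSHFR PBot) {η : ℝ} {f : ℂ → ℂ} {x₀ s hmax R Hs : ℝ} {B : ℕ}
    (hE : EngineHyps5 2 η f x₀ s hmax R Hs B) :
    ∃ j : ℕ, (j : ℝ) ≤ (Hs / s) ^ 2 + (B : ℝ) + 1 + 4 * hmax / s ∧ ∀ u : ℂ, ReadyR2 η f x₀ s hmax R Hs B j u :=
  exists_readyR2_le hR alphaSealTrkS_bot hE
end Horizon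

end RhW08.SealSwap

namespace RhW08.SealSwap

open Complex
open RhIdea6.G17.W07C7 RhIdea6.G17.W07C7.Rev6 RhIdea6.G18.W07C8.Law421BirthS RhIdea6.G19.W07C11.Seam
open RhIdea6.G20.W07C12.Frac RhIdea6.G20.W07C12.StColP RhW07.C12.FieldSplit RhIdea6.G21.W07C13.TentMax
open RhW07.C14.TwoSided RhW07.C14.Classes RhW07.C14.Lineage RhW07.C14.Booking
open RhW07.C13.Heredity RhIdea6.G22.W07C15pre.Injection RhW07.E3.Cell
open RhW07.E3.Lit
open RhW08.Round1 RhW08.StSwap RhW08.Round2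

section BotStubs

/-- ★★★ §R3B STUB TEXT 1 — (S♮) «NO SILENT EXTINCTION» at the empty seal: on every legal frame (`EngineHyps5 2`), every CHARGED level `j` of the seal-free
family `PTrkS PBot` (its lowest tracked state is not Ready′ — no sign window and no 421-event at any level `≤ j` near the column — and NO tracked state of level `j+1`
sits at least `s/4` lower, cf. `chargedBot_iff`) still has an INHABITED tracked successor level `j+1`.
Analytic content (why it is a genuine stub): a Laguerre/Jensen step for real entire `f` of order `< 2` with all zeros in `|Im| ≤ Hs` — «no NL-event of `f^{(j)}` near the
column ⇒ `f^{(j+1)}` keeps a NON-REAL zero inside the down-first window `|Re − x₀| ≤ R/2 + (j+1)s/4`, `0 < Im ≤ Hs`, continuing the tracked chain».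
Why it might fail: horizontal drift of the tracked lineage beyond the window's growth of `s/4` per level. -/
def RestSuccBot : Prop :=
  ∀ (η : ℝ) (f : ℂ → ℂ) (x₀ s hmax R Hs : ℝ) (B : ℕ), EngineHyps5 2 η f x₀ s hmax R Hs B →
    ∀ j : ℕ, Charged (PTrkS PBot) StTrkD ReadyR2 η f x₀ s hmax R Hs B j → ∃ u' : ℂ, StTrkD η f x₀ s hmax R Hs B (j + 1) u'

open Classical in
/-- ★★★ §R3B STUB TEXT 2 — (R) «THE RATE INEQUALITY» of the seal-free signed REST at the booked-root meter (telescoped rate form of β(⊥), C4 §K.16c): on every legal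
frame, for EVERY prefix `k`,
`chargeCount k + (T₀ᴿ − injected k)⁺ + 4·lowH k/s + Σ_{j<k}[¬Charged j] 4·(lowH j − lowH (j+1))/s ≤ (Hs/s)² + B + 1 + 4·hmax/s`
(«charged levels so far + unspent root credit + current lowest tracked height in units of `s/4` + the drops of the FREE levels in units of `s/4` ≤ LAW 421's depth purse»;
`T₀ᴿ = tentMeterTrkD (3/2) … 0` the booked root's `3/2`-tent count, `injected k` the charged NON-empty-tent levels below `k`, `lowH j` the lowest tracked height of level `j`).
The `k = 0` instance is INIT♯ (`restInitBot_of_rate`). Why it might fail: a HOVERING un-ready lineage (many charged levels with drop ≈ 0 after the credit window `injected k ≤ T₀ᴿ`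
closes, cost ≈ 1 each) in a low-budget frame; C6 ADD-84: NEG 0 / 2 200 comb frames, floor +1.000 at `k = 0`. -/
def RestRateBot : Prop :=
  ∀ (η : ℝ) (f : ℂ → ℂ) (x₀ s hmax R Hs : ℝ) (B : ℕ), EngineHyps5 2 η f x₀ s hmax R Hs B →
    ∀ k : ℕ, chargeCount (PTrkS PBot) StTrkD ReadyR2 η f x₀ s hmax R Hs B k
        + max (tentMeterTrkD (3 / 2) η f x₀ s hmax R Hs B 0 - injected (PTrkS PBot) StTrkD ReadyR2 EmptyTrkD η f x₀ s hmax R Hs B k) 0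
        + 4 * lowH StTrkD η f x₀ s hmax R Hs B k / s
        + (∑ j ∈ Finset.range k, (if Charged (PTrkS PBot) StTrkD ReadyR2 η f x₀ s hmax R Hs B j then 0 else
            4 * (lowH StTrkD η f x₀ s hmax R Hs B j - lowH StTrkD η f x₀ s hmax R Hs B (j + 1)) / s))
      ≤ (Hs / s) ^ 2 + (B : ℝ) + 1 + 4 * hmax / s

/-- ★ §R3B the k-0 INIT♯ text in HEIGHT-PURSE units (director (CA328)(3) wording): on every legal frame `0 ≤ heightBudget (tentMeterTrkD (3/2)) StTrkD …`, i.e.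
`T₀ᴿ ≤ (Hs/s)² + B + 1 + 4·(hmax − rootHeight)/s` (`restInitBot_iff_purse`). NOT a stub of the round-3 line: it is the `k = 0` instance of `RestRateBot` (`restInitBot_of_rate`)
and C4 §K.17 proves it on all legal data (helper). -/
def RestInitBot : Prop :=
  ∀ (η : ℝ) (f : ℂ → ℂ) (x₀ s hmax R Hs : ℝ) (B : ℕ), EngineHyps5 2 η f x₀ s hmax R Hs B →
    0 ≤ heightBudget (tentMeterTrkD (3 / 2)) StTrkD η f x₀ s hmax R Hs B

/-- (K) §R3B the rate form of β(⊥) IS the conjunction of the two stub texts (frame-wise regrouping, no mathematics). -/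
theorem rateRestTrkS_bot_iff : RateRestTrkS PBot ↔ (RestSuccBot ∧ RestRateBot) :=
  ⟨fun h => ⟨fun η f x₀ s hmax R Hs B hE => (h η f x₀ s hmax R Hs B hE).1, fun η f x₀ s hmax R Hs B hE => (h η f x₀ s hmax R Hs B hE).2⟩,
    fun h η f x₀ s hmax R Hs B hE => ⟨h.1 η f x₀ s hmax R Hs B hE, h.2 η f x₀ s hmax R Hs B hE⟩⟩

/-- ★★★ §R3B (K) **THE PROVED COMPOSITION OF OPTION B**: `RestSuccBot → RestRateBot → ZRestTrkSHFR PBot` (via C4 `zRestTrkSHFR_iff_rate PBot`). -/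
theorem zRestTrkSBot_of_succ_rate (hS : RestSuccBot) (hR : RestRateBot) : ZRestTrkSHFR PBot :=
  (zRestTrkSHFR_iff_rate PBot).mpr (rateRestTrkS_bot_iff.mpr ⟨hS, hR⟩)

/-- (K) §R3B conversely β(⊥) returns stub text 1 … -/
theorem restSuccBot_of_bot (h : ZRestTrkSHFR PBot) : RestSuccBot :=
  (rateRestTrkS_bot_iff.mp ((zRestTrkSHFR_iff_rate PBot).mp h)).1

/-- (K) §R3B … and stub text 2: the split loses nothing. -/
theorem restRateBot_of_bot (h : ZRestTrkSHFR PBot) : RestRateBot :=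
  (rateRestTrkS_bot_iff.mp ((zRestTrkSHFR_iff_rate PBot).mp h)).2

/-- ★★ §R3B (K) `β(⊥) ↔ RestSuccBot ∧ RestRateBot`. -/
theorem zRestTrkSHFR_bot_iff_succ_rate : ZRestTrkSHFR PBot ↔ (RestSuccBot ∧ RestRateBot) :=
  ⟨fun h => ⟨restSuccBot_of_bot h, restRateBot_of_bot h⟩, fun h => zRestTrkSBot_of_succ_rate h.1 h.2⟩

/-- ★★★ §R3B (K) **THE ROUND-3 NODE BY NAMES**: `RestSuccBot → RestRateBot → TiltedLandingLaw421` (`law421T_of_alphaFree ∘ zRestTrkSBot_of_succ_rate`). -/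
theorem law421T_of_succ_rate (hS : RestSuccBot) (hR : RestRateBot) :
    Summit.RiemannHypothesis.RiemannHypothesis.Theses.EarlyAppointments.TiltedLandingLaw421 :=
  law421T_of_alphaFree (zRestTrkSBot_of_succ_rate hS hR)

/-- ★ §R3B (K) the STOP-TIME bound is a corollary of the two stub texts (C4 §K.16d `exists_readyR2_le_alphaFree`): `∃ j ≤ (Hs/s)² + B + 1 + 4hmax/s, ∀ u, ReadyR2 … j u`. -/
theorem exists_readyR2_le_of_succ_rate (hS : RestSuccBot) (hR : RestRateBot) {η : ℝ} {f : ℂ → ℂ} {x₀ s hmax R Hs : ℝ} {B : ℕ}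
    (hE : EngineHyps5 2 η f x₀ s hmax R Hs B) :
    ∃ j : ℕ, (j : ℝ) ≤ (Hs / s) ^ 2 + (B : ℝ) + 1 + 4 * hmax / s ∧ ∀ u : ℂ, ReadyR2 η f x₀ s hmax R Hs B j u :=
  exists_readyR2_le_alphaFree (zRestTrkSBot_of_succ_rate hS hR) hE

/-- ★★ §R3B (K) THE SEAL-FREE CHARGE PREDICATE IN WORDS: level `j` is charged iff its lowest tracked state `v` is not Ready′ and EVERY tracked state of level `j+1` is
`< s/4` lower than `v` (no seal clause at all — this is the column C6/C2/critic price as R5ᴿ(⊥)). -/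
theorem chargedBot_iff {η : ℝ} {f : ℂ → ℂ} {x₀ s hmax R Hs : ℝ} {B j : ℕ} :
    Charged (PTrkS PBot) StTrkD ReadyR2 η f x₀ s hmax R Hs B j ↔
      ∃ v : ℂ, IsLowest StTrkD η f x₀ s hmax R Hs B j v ∧ ¬ ReadyR2 η f x₀ s hmax R Hs B j v ∧
        ∀ u' : ℂ, StTrkD η f x₀ s hmax R Hs B (j + 1) u' → |v.im| < |u'.im| + 1 / 4 * s := by
  constructor
  · rintro ⟨v, hlow, hnr, hnP⟩
    refine ⟨v, hlow, hnr, fun u' hu' => ?_⟩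
    by_contra h
    exact hnP (Or.inr ⟨u', hu', not_lt.mp h⟩)
  · rintro ⟨v, hlow, hnr, hall⟩
    refine ⟨v, hlow, hnr, fun h => ?_⟩
    rcases h with hb | ⟨u', hu', hle⟩
    · exact hb.elim
    · exact absurd hle (not_le.mpr (hall u' hu'))

/-- (K) §R3B INIT♯ in purse units: `RestInitBot ↔ ∀ legal frame, T₀ᴿ ≤ (Hs/s)² + B + 1 + 4·(hmax − rootHeight StTrkD)/s` (= the statement C4 §K.17 `tentMeterTrkD_zero_le_purse` proves). -/
theorem restInitBot_iff_purse : RestInitBot ↔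
    ∀ (η : ℝ) (f : ℂ → ℂ) (x₀ s hmax R Hs : ℝ) (B : ℕ), EngineHyps5 2 η f x₀ s hmax R Hs B →
      tentMeterTrkD (3 / 2) η f x₀ s hmax R Hs B 0 ≤ (Hs / s) ^ 2 + (B : ℝ) + 1 + 4 * (hmax - rootHeight StTrkD η f x₀ s hmax R Hs B) / s := by
  constructor
  · intro h η f x₀ s hmax R Hs B hE
    have h1 := h η f x₀ s hmax R Hs B hE
    simp only [heightBudget] at h1
    linarith
  · intro h η f x₀ s hmax R Hs B hE
    have h1 := h η f x₀ s hmax R Hs B hE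
    simp only [heightBudget]
    linarith

/-- ★ §R3B (K) INIT♯ IS THE `k = 0` INSTANCE OF THE RATE INEQUALITY (`chargeCount 0 = 0`, `injected 0 = 0`, `lowH 0 = rootHeight`, empty free-drop sum, `T₀ᴿ ≤ (T₀ᴿ − 0)⁺`) —
so a separate INIT stub would be redundant next to `RestRateBot`. -/
theorem restInitBot_of_rate (h : RestRateBot) : RestInitBot := by
  classical
  intro η f x₀ s hmax R Hs B hE
  have h0 := h η f x₀ s hmax R Hs B hE 0
  rw [chargeCount_zero, lowH_zero, Finset.sum_range_zero] at h0
  have hinj : injected (PTrkS PBot) StTrkD ReadyR2 EmptyTrkD η f x₀ s hmax R Hs B 0 = 0 := by simp [injected]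
  rw [hinj, sub_zero] at h0
  have hT : tentMeterTrkD (3 / 2) η f x₀ s hmax R Hs B 0 ≤ max (tentMeterTrkD (3 / 2) η f x₀ s hmax R Hs B 0) 0 := le_max_left _ _
  have h4 : 4 * (hmax - rootHeight StTrkD η f x₀ s hmax R Hs B) / s = 4 * hmax / s - 4 * rootHeight StTrkD η f x₀ s hmax R Hs B / s := by ring
  simp only [heightBudget]
  rw [h4]
  linarith
end BotStubs

end RhW08.SealSwap
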